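/-
Copyright (c) 2026 the pub-hodgecm-mathlib formalisation cell (harness21).  Prover seat hodgecm-mathlib-K2E3-p05 (g3), Track B «K2-LIT», engine E3, unit U4 «Keys»,
2026-09-04.  KERNEL module: THEOREMS ONLY (no definition, no named fact, no `sorry`, no instance, no notation).
-/
import Summits.HodgeConjecture.HodgeConjecture.Theorems.K2E3KeysThmTwoContractingUnramified   -- ★-filed p856959 (this seat): the unramified rung of U4-f; brings ★ quartet p856874 (`weyl_levelTrivial`)
import Summits.HodgeConjecture.HodgeConjecture.Theorems.K2E3KeysThmTwoOfContracting            -- ★ p855154 (g0): the flip pattern; brings ★ p855078 `cmPrincipalSeries_weylConj_reducible_of_reducible`, ★ p855108 dichotomy, ★ UniqPar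
import Summits.HodgeConjecture.HodgeConjecture.Theorems.K2E3IrregularReducibleCaseThree         -- ★ p856178 (K2E3-p06 g2): socket U4-c PAID — case (3) at `wχ = χ`, every non-split `v`
import Summits.HodgeConjecture.HodgeConjecture.Theorems.F0P3cStCharTSPSIrredRegular             -- ★ Bruhat: `cmWeylTorusCharPair_eq_of_ne_bot_ne_top` (a reducible UNITARY `i_G(χ)` is `w`-fixed)
import HarnessLib

/-!
# K2 ∕ E3 «EllipticInputs», unit U4 «Keys» — KEYS' REDUCIBILITY LIST (tier-0 stub 4, direction ⇒) FOR THE UNRAMIFIED PRINCIPAL SERIES AT EVERY INERT PLACE: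
# `i_G(χ)` reducible, `χ` trivial on `T ∩ K_v` ⇒ `χ₁ ∈ {‖·‖^{±1}} ∪ {η‖·‖^{±1∕2} : η|F^× = ω} ∪ {χ₁ ≠ 1, χ₁|F^× = 1}`  [Keys1984 §7 Thm; Rogawski1990 §12.2 (1)(2)(3); Casselman1980 §3]

Cell hodgecm-mathlib (D-0151), FLOOR 0, Track B «K2-LIT», engine E3, crux item H413 = stmt-HodgeConjecture-24833 (route `HCCMUnconditional`, no route verbs).  Author K2E3-p05 (g3).
`--supports stmt-HodgeConjecture-24833 --as helper`; THEOREMS ONLY.  The POINTWISE composition of the unramified rung ★-filed p856959 `keysThmTwoContracting_of_unramified_inert`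
(Keys Thm (2), «Re s > 0» form, `v` inert, `χ` unramified) with the lineage's two reductions — the Weyl flip of ★ p855154 `keysThmTwo_of_contracting` (expanding ↦ contracting, the
flipped pair is again trivial on `T ∩ K_v`: ★ `weyl_levelTrivial`) and the unitary∕non-unitary split of ★ p855006 `keysReducibleList_of_keysThmTwo_of_irregularCaseThree` with the
irregular case ★ p856178 `irregularReducibleCaseThree` (UNCONDITIONAL at every non-split `v`) — gives the bytes of tier-0 `stub_keysReducibleList` POINTWISE at every INERT `v` for every
continuous `χ` trivial on `T ∩ K_v`: §1 the four-point form, §2 the three-way list.  What it is NOT: the stub itself (ramified places, ramified `χ` remain — MEMO v4).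
HONEST LABEL: HC_CM is proved only modulo the 7 printed citations (2 remaining named inputs: hLiu418 = stmt-HodgeConjecture-24832, h413 = stmt-HodgeConjecture-24833)
until rung 0 closes; count-neutral (no socket is paid; no printed citation is discharged).

## References
* [Keys1984] D. Keys, *Principal series representations of special unitary groups over local fields*, Compositio Math. 51 (1984), §7 Theorem (1)–(2) p. 126.
* [Rogawski1990] J. D. Rogawski, Ann. of Math. Stud. 123 (1990), §12.2 (1)–(3) p. 173.  * [Casselman1980] W. Casselman, Compositio Math. 40 (1980), §3.
* [BernsteinZelevinsky1977] I. N. Bernstein, A. V. Zelevinsky, Ann. Sci. ÉNS 10 (1977), Thm. 2.9 (`i_G(χ)`, `i_G(wχ)` have the same constituents).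
-/

set_option autoImplicit false
-- the mandated namespace has the single-problem summit's repeated segment (`HodgeConjecture.HodgeConjecture`)
set_option linter.dupNamespace false

noncomputable section

open NumberField IsDedekindDomain MeasureTheory
open scoped Matrix MatrixGroups NNReal
open Literature.NumberTheory Literature.NumberTheory.Automorphic Literature.NumberTheory.Automorphic.UnitaryGroup
open Literature.NumberTheory.Rogawski1990 Literature.NumberTheory.GaloisRepresentations

namespace Summit.HodgeConjecture.HodgeConjecture.Cruxes.H413.K2E3KeysReducibleListUnramifiedInert

open Summit.HodgeConjecture.HodgeConjecture.Cruxes.H413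
open Summit.HodgeConjecture.HodgeConjecture.Cruxes.H413.K2E3KeysThmTwoContractingUnramified
open Summit.HodgeConjecture.HodgeConjecture.Cruxes.H413.K2E3KeysThmTwoIwahoriQuartet

variable (L : Type) [Field L] [NumberField L] [IsCMField L] (v : HeightOneSpectrum (𝓞 ↥(maximalRealSubfield L)))

/-! ## §1 The four-point form at an inert place for an unramified `χ` (the Weyl flip of ★ p855154, pointwise) -/

set_option synthInstance.maxHeartbeats 400000 in
set_option maxHeartbeats 1600000 in
-- statement-heavy: the `SmoothInd` carrier of `cmPrincipalSeries` (same budget as ★ p855154)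
/-- **[Keys1984 §7 Thm (2)], four-point form, AT AN INERT PLACE FOR AN UNRAMIFIED `χ`.**  `v` non-split (`hns`) and unramified in `L` (`hunr`); `χ = (χ₁, χ₂)` continuous, trivial on
`T ∩ K_v` (`hU`), `χ₁` NON-UNITARY; `i_G(χ)` reducible ⇒ `χ₁ = ‖·‖^{±1}` or `χ₁ = η‖·‖^{±1∕2}` with `η|_{F_v^×} = ω_{E_v∕F_v}`, `η` continuous.  Contracting: ★ the rung; expanding:
flip by `w` (★ `conjInvChar_contracting_of_expanding`, ★ `cmPrincipalSeries_weylConj_reducible_of_reducible`, the flipped pair is trivial on `T ∩ K_v` by ★ `weyl_levelTrivial`) and flip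
back (`w² = 1`, ★ `conjInvChar_normSqInv`, ★ `conjInvChar_quadChar_mul_half`). [cite: Keys1984, §7 Theorem (2) p. 126] [cite: Rogawski1990, §12.2 (1)–(2) p. 173] [cite: BernsteinZelevinsky1977, Thm. 2.9] -/
theorem keysThmTwo_of_unramified_inert (hns : ∀ w : PlacesOver L v, IsCMField.complexConj L • w.1 = w.1) (hunr : Algebra.IsUnramifiedIn (𝓞 L) v.asIdeal)
    (χ₁ : (UnitaryGroup.LocalRing L v)ˣ →* ℂˣ) (χ₂ : ↥(normOneUnits (conjLocal L (IsCMField.complexConj L) v)) →* ℂˣ)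
    (h₁ : Continuous (fun x => ((χ₁ x : ℂˣ) : ℂ))) (h₂ : Continuous (fun x => ((χ₂ x : ℂˣ) : ℂ))) (hnu : ∃ x, ‖((χ₁ x : ℂˣ) : ℂ)‖ ≠ 1)
    (hU : ∀ t : ↥(torusU (conjLocal L (IsCMField.complexConj L) v) (cmLocalForm L 3 v)),
      (t : ↥(unitaryGroupOfForm (conjLocal L (IsCMField.complexConj L) v) (cmLocalForm L 3 v))) ∈ cmLocalIntegralLevel L 3 (qsForm L) v → cmTorusCharPair L v χ₁ χ₂ t = 1)
    (hred : ∃ N : Subrepresentation (UnitaryGroup.cmPrincipalSeries L 3 v (UnitaryGroup.cmTorusCharPair L v χ₁ χ₂)), N ≠ ⊥ ∧ N ≠ ⊤) :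
    (χ₁ = halfModulusChar (UnitaryGroup.LocalRing L v) * halfModulusChar (UnitaryGroup.LocalRing L v) ∨
        χ₁ = (halfModulusChar (UnitaryGroup.LocalRing L v) * halfModulusChar (UnitaryGroup.LocalRing L v))⁻¹) ∨
      (∃ η : (UnitaryGroup.LocalRing L v)ˣ →* ℂˣ, IsQuadraticCharExtension (conjLocal L (IsCMField.complexConj L) v) η ∧
        Continuous (fun x => ((η x : ℂˣ) : ℂ)) ∧
        (χ₁ = η * halfModulusChar (UnitaryGroup.LocalRing L v) ∨ χ₁ = η * (halfModulusChar (UnitaryGroup.LocalRing L v))⁻¹)) := by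
  rcases K2E3NonUnitaryCharacterDichotomy.contracting_or_expanding_of_exists_norm_ne_one L v hns χ₁ h₁ hnu with hc | he
  · rcases keysThmTwoContracting_of_unramified_inert L v hns hunr χ₁ χ₂ h₁ h₂ hnu hc hU hred with h | ⟨η, hq, hηc, h⟩
    · exact Or.inl (Or.inl h)
    · exact Or.inr ⟨η, hq, hηc, Or.inl h⟩
  · -- the expanding case: flip by `w` (the flipped pair is again unramified)
    have h₁' : Continuous fun x => ((UnitaryGroup.conjInvChar (conjLocal L (IsCMField.complexConj L) v) χ₁ x : ℂˣ) : ℂ) :=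
      F0P2pTorusPairsAndVacuity.continuous_coe_conjInvChar _ (continuous_conjLocal L (IsCMField.complexConj L) v) χ₁ h₁
    have hnu' := K2E3NonUnitaryCharacterDichotomy.exists_norm_conjInvChar_ne_one L v χ₁ hnu
    have hc' : ∀ x : (UnitaryGroup.LocalRing L v)ˣ, unitModulusChar (UnitaryGroup.LocalRing L v) x < 1 →
        ‖((UnitaryGroup.conjInvChar (conjLocal L (IsCMField.complexConj L) v) χ₁ x : ℂˣ) : ℂ)‖ < 1 :=
      fun x hx => K2E3NonUnitaryCharacterDichotomy.conjInvChar_contracting_of_expanding L v χ₁ he x hx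
    have hreg := K2E3NonUnitaryCharacterDichotomy.cmTorusCharPair_ne_weyl_of_exists_norm_ne_one L v hns χ₁ χ₂ h₁ hnu
    have hred' := K2E3PrincipalSeriesWeylReducible.cmPrincipalSeries_weylConj_reducible_of_reducible L v hns χ₁ χ₂ h₁ h₂ hreg hred
    have hU' := weyl_levelTrivial L v hns χ₁ χ₂ hU
    have hww : UnitaryGroup.conjInvChar (conjLocal L (IsCMField.complexConj L) v)
        (UnitaryGroup.conjInvChar (conjLocal L (IsCMField.complexConj L) v) χ₁) = χ₁ :=
      F0P2pTorusPairsAndVacuity.conjInvChar_conjInvChar _ (conjLocal_conjLocal_cm L v) χ₁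
    have hsq : UnitaryGroup.conjInvChar (conjLocal L (IsCMField.complexConj L) v)
        (halfModulusChar (UnitaryGroup.LocalRing L v) * halfModulusChar (UnitaryGroup.LocalRing L v)) =
          (halfModulusChar (UnitaryGroup.LocalRing L v) * halfModulusChar (UnitaryGroup.LocalRing L v))⁻¹ := by
      have e := congrArg (UnitaryGroup.conjInvChar (conjLocal L (IsCMField.complexConj L) v)) (F0P3cStCharTSUniqPar.conjInvChar_normSqInv L v)
      rw [F0P2pTorusPairsAndVacuity.conjInvChar_conjInvChar _ (conjLocal_conjLocal_cm L v)] at e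
      exact e.symm
    rcases keysThmTwoContracting_of_unramified_inert L v hns hunr (UnitaryGroup.conjInvChar (conjLocal L (IsCMField.complexConj L) v) χ₁) χ₂ h₁' h₂ hnu' hc' hU' hred'
      with h | ⟨η, hq, hηc, h⟩
    · refine Or.inl (Or.inr ?_)
      rw [← hww, h, hsq]
    · refine Or.inr ⟨η, hq, hηc, Or.inr ?_⟩
      rw [← hww, h, F0P3cStCharTSUniqPar.conjInvChar_quadChar_mul_half L v η hq]

/-! ## §2 The three-way list of tier-0 stub 4 at an inert place for an unramified `χ` -/

set_option synthInstance.maxHeartbeats 400000 in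
set_option maxHeartbeats 1600000 in
-- statement-heavy: the `SmoothInd` carrier of `cmPrincipalSeries` (same budget as ★ p855006)
/-- **KEYS' REDUCIBILITY LIST (⇒) FOR THE UNRAMIFIED PRINCIPAL SERIES AT AN INERT PLACE** — the bytes of tier-0 `stub_keysReducibleList` POINTWISE, under `hunr` (`v` unramified in `L`;
with `hns`, inert) and `hU` (`χ` trivial on `T ∩ K_v`): if `i_G(χ₁, χ₂)` has a proper non-zero `G_v`-stable subspace then (1) `χ₁ = ‖·‖^{±1}`, or (2) `χ₁ = η‖·‖^{±1∕2}` with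
`η|_{F_v^×} = ω_{E_v∕F_v}`, `η` continuous, or (3) `χ₁ ≠ 1` and `χ₁|_{F_v^×} = 1`.  Unitary `χ₁`: ★ Bruhat `cmWeylTorusCharPair_eq_of_ne_bot_ne_top` ⇒ `wχ = χ` ⇒ (3) by ★ p856178
`irregularReducibleCaseThree`; non-unitary: §1. [cite: Keys1984, §7 Theorem (1)–(2) p. 126] [cite: Rogawski1990, §12.2 (1)–(3) p. 173] [cite: Casselman1980, §3] -/
theorem keysReducibleList_of_unramified_inert (hns : ∀ w : PlacesOver L v, IsCMField.complexConj L • w.1 = w.1) (hunr : Algebra.IsUnramifiedIn (𝓞 L) v.asIdeal)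
    (χ₁ : (UnitaryGroup.LocalRing L v)ˣ →* ℂˣ) (χ₂ : ↥(normOneUnits (conjLocal L (IsCMField.complexConj L) v)) →* ℂˣ)
    (h₁ : Continuous (fun x => ((χ₁ x : ℂˣ) : ℂ))) (h₂ : Continuous (fun x => ((χ₂ x : ℂˣ) : ℂ)))
    (hU : ∀ t : ↥(torusU (conjLocal L (IsCMField.complexConj L) v) (cmLocalForm L 3 v)),
      (t : ↥(unitaryGroupOfForm (conjLocal L (IsCMField.complexConj L) v) (cmLocalForm L 3 v))) ∈ cmLocalIntegralLevel L 3 (qsForm L) v → cmTorusCharPair L v χ₁ χ₂ t = 1)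
    (hred : ∃ N : Subrepresentation (UnitaryGroup.cmPrincipalSeries L 3 v (UnitaryGroup.cmTorusCharPair L v χ₁ χ₂)), N ≠ ⊥ ∧ N ≠ ⊤) :
    (χ₁ = halfModulusChar (UnitaryGroup.LocalRing L v) * halfModulusChar (UnitaryGroup.LocalRing L v) ∨
        χ₁ = (halfModulusChar (UnitaryGroup.LocalRing L v) * halfModulusChar (UnitaryGroup.LocalRing L v))⁻¹) ∨
      (∃ η : (UnitaryGroup.LocalRing L v)ˣ →* ℂˣ, IsQuadraticCharExtension (conjLocal L (IsCMField.complexConj L) v) η ∧ Continuous (fun x => ((η x : ℂˣ) : ℂ)) ∧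
        (χ₁ = η * halfModulusChar (UnitaryGroup.LocalRing L v) ∨ χ₁ = η * (halfModulusChar (UnitaryGroup.LocalRing L v))⁻¹)) ∨
      (χ₁ ≠ 1 ∧ ∀ a : (UnitaryGroup.LocalRing L v)ˣ, (conjLocal L (IsCMField.complexConj L) v) (a : UnitaryGroup.LocalRing L v) = a → χ₁ a = 1) := by
  by_cases hu : ∀ x, ‖((χ₁ x : ℂˣ) : ℂ)‖ = 1
  · -- unitary: ★ Bruhat ⇒ `wχ = χ`; ★ p856178 ⇒ disjunct (3)
    have hw : UnitaryGroup.cmWeylTorusCharPair L v χ₁ χ₂ = UnitaryGroup.cmTorusCharPair L v χ₁ χ₂ :=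
      F0P3cStCharTSPSIrredRegular.cmWeylTorusCharPair_eq_of_ne_bot_ne_top L v hns χ₁ χ₂ h₁ h₂ hu hred
    have hfix : UnitaryGroup.cmTorusCharPair L v χ₁ χ₂ =
        UnitaryGroup.cmTorusCharPair L v (UnitaryGroup.conjInvChar (conjLocal L (IsCMField.complexConj L) v) χ₁) χ₂ :=
      ((UnitaryGroup.cmWeylTorusCharPair_eq L v χ₁ χ₂).symm.trans hw).symm
    exact Or.inr (Or.inr (K2E3IrregularReducibleCaseThree.irregularReducibleCaseThree L v hns χ₁ χ₂ h₁ h₂ hfix hred))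
  · -- non-unitary: §1 ⇒ disjunct (1) or (2)
    push Not at hu
    rcases keysThmTwo_of_unramified_inert L v hns hunr χ₁ χ₂ h₁ h₂ hu hU hred with h | h
    · exact Or.inl h
    · exact Or.inr (Or.inl h)

/-! ## §3 The hypothesis `hU` from the characters: `χ₁ = 1` on `𝒪_vˣ` and `χ₂ = 1` -/

/-- **`hU` ⟸ (`χ₁|_{𝒪_vˣ} = 1` and `χ₂ = 1`)**: the pair character `χ = (χ₁, χ₂)` is trivial on `T ∩ K_v` as soon as `χ₁` is trivial on `𝒪_vˣ` and `χ₂` is trivial (the diagonal of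
`t ∈ T ∩ K_v` is unit-valued, ★ `v_torusEntry_eq_one_of_mem_cmLocalIntegralLevel`; `χ(t) = χ₁(t₀₀)·χ₂(det t)`).  With §1 of ★ p856874 (`hU ⇒ χ₂ = 1`, ★ (H1) `hU ⇒ χ₁|_{𝒪_vˣ} = 1`)
this is an equivalence: «`χ` unramified». [cite: Rogawski1990, §12.1 p. 171; §12.2 p. 173] [cite: Casselman1980, §3] -/
theorem levelTrivial_of_unramified (χ₁ : (UnitaryGroup.LocalRing L v)ˣ →* ℂˣ) (χ₂ : ↥(normOneUnits (conjLocal L (IsCMField.complexConj L) v)) →* ℂˣ)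
    (hχ₁ : ∀ u ∈ (Submonoid.pi Set.univ (fun w : PlacesOver L v => (w.1.adicCompletionIntegers L).toSubring.toSubmonoid)).units, χ₁ u = 1) (hχ₂ : χ₂ = 1) :
    ∀ t : ↥(torusU (conjLocal L (IsCMField.complexConj L) v) (cmLocalForm L 3 v)),
      (t : ↥(unitaryGroupOfForm (conjLocal L (IsCMField.complexConj L) v) (cmLocalForm L 3 v))) ∈ cmLocalIntegralLevel L 3 (qsForm L) v → cmTorusCharPair L v χ₁ χ₂ t = 1 := by
  intro t ht
  rw [cmTorusCharPair, torusCharPair_apply, hχ₂, MonoidHom.one_apply, mul_one]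
  refine hχ₁ _ ((F0P3cStCharTSTorusCompactPart.mem_unitsIntegers_iff L v _).2 fun w => ?_)
  exact v_torusEntry_eq_one_of_mem_cmLocalIntegralLevel L 3 v t ht 0 w

set_option synthInstance.maxHeartbeats 400000 in
set_option maxHeartbeats 1600000 in
-- statement-heavy: the `SmoothInd` carrier of `cmPrincipalSeries` (same budget as ★ p855006)
/-- **KEYS' LIST (⇒) AT AN INERT PLACE, CHARACTER-LEVEL HYPOTHESES**: `χ₁` trivial on `𝒪_vˣ`, `χ₂ = 1`, `i_G(χ₁, 1)` reducible ⇒ the three-way list of tier-0 `stub_keysReducibleList`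
(§2 ∘ §3 `levelTrivial_of_unramified`). [cite: Keys1984, §7 Theorem (1)–(2) p. 126] [cite: Rogawski1990, §12.2 (1)–(3) p. 173] -/
theorem keysReducibleList_of_unramified_inert' (hns : ∀ w : PlacesOver L v, IsCMField.complexConj L • w.1 = w.1) (hunr : Algebra.IsUnramifiedIn (𝓞 L) v.asIdeal)
    (χ₁ : (UnitaryGroup.LocalRing L v)ˣ →* ℂˣ) (χ₂ : ↥(normOneUnits (conjLocal L (IsCMField.complexConj L) v)) →* ℂˣ)
    (h₁ : Continuous (fun x => ((χ₁ x : ℂˣ) : ℂ))) (h₂ : Continuous (fun x => ((χ₂ x : ℂˣ) : ℂ)))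
    (hχ₁ : ∀ u ∈ (Submonoid.pi Set.univ (fun w : PlacesOver L v => (w.1.adicCompletionIntegers L).toSubring.toSubmonoid)).units, χ₁ u = 1) (hχ₂ : χ₂ = 1)
    (hred : ∃ N : Subrepresentation (UnitaryGroup.cmPrincipalSeries L 3 v (UnitaryGroup.cmTorusCharPair L v χ₁ χ₂)), N ≠ ⊥ ∧ N ≠ ⊤) :
    (χ₁ = halfModulusChar (UnitaryGroup.LocalRing L v) * halfModulusChar (UnitaryGroup.LocalRing L v) ∨
        χ₁ = (halfModulusChar (UnitaryGroup.LocalRing L v) * halfModulusChar (UnitaryGroup.LocalRing L v))⁻¹) ∨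
      (∃ η : (UnitaryGroup.LocalRing L v)ˣ →* ℂˣ, IsQuadraticCharExtension (conjLocal L (IsCMField.complexConj L) v) η ∧ Continuous (fun x => ((η x : ℂˣ) : ℂ)) ∧
        (χ₁ = η * halfModulusChar (UnitaryGroup.LocalRing L v) ∨ χ₁ = η * (halfModulusChar (UnitaryGroup.LocalRing L v))⁻¹)) ∨
      (χ₁ ≠ 1 ∧ ∀ a : (UnitaryGroup.LocalRing L v)ˣ, (conjLocal L (IsCMField.complexConj L) v) (a : UnitaryGroup.LocalRing L v) = a → χ₁ a = 1) :=
  keysReducibleList_of_unramified_inert L v hns hunr χ₁ χ₂ h₁ h₂ (levelTrivial_of_unramified L v χ₁ χ₂ hχ₁ hχ₂) hred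

end Summit.HodgeConjecture.HodgeConjecture.Cruxes.H413.K2E3KeysReducibleListUnramifiedInert

end
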